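import Literature.Geometry.Riemannian.GurskyViaclovskyClosednessChartEllipticity
import Literature.Geometry.Riemannian.GurskyViaclovskyClosednessChartSmoothness
import Literature.Geometry.Riemannian.GurskyViaclovskyClosednessCovectorBounds
import HarnessLib

/-!
# Gursky–Viaclovsky closedness: the chart symbol in Euclidean coordinates and joint smoothness
# of the chart operator in `(t, y, p, r)`

Support file (everything PROVED; no definition, no named fact) for the named fact
`Literature.Geometry.Riemannian.gurskyViaclovsky_pathClosed_weighted_four`: a brick of the
Gilbarg–Trudinger Lemma 17.16 bootstrap (uniform higher-order chart bounds from the Evans–Krylov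
`C^{2,α}` bound) for the chart form `chartOperator G t W y (DU) (D²U) = q̃ e^{4U}` of the
background equation (`GurskyViaclovskyClosednessChartEquation.lean`).

* `contDiffOn_gvForm_comp`, `contDiffOn_chartOperator_comp`, `contDiffOn_gvForm_param`,
  `contDiffOn_chartOperator_param` — Gursky–Viaclovsky's form `𝒜^t(y, p, r)` and the chart
  operator are `C^∞` along any smoothly varying data `(t, y, p, r) = (τ x, π x, p x, r x)`,
  `π(D) ⊆ V`, in particular JOINTLY in `(t, y, p, r)` on `ℝ × V × E* × Bil(E)` (the form is
  affine in `t`; the pieces `Γ`, `Ric`, `R`, `G⁻¹` of the components are `C^∞` on `V`, as in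
  `GurskyViaclovskyClosednessChartSmoothness.lean`, which is the case `t` fixed);
* `fderiv_chartOperator_smulRight` — the `r`-derivative of the chart operator in the rank-one
  direction `η ⊗ η` is the symbol `4 Σ L^t(M)_{ac} ζ_aζ_c` of `hasDerivAt_chartOperator`;
* `symbol_euclid_bounds_along_solution` — Gilbarg–Trudinger's structure condition (17.43) in the
  EUCLIDEAN norm of the covector: along a solution with the covariant bounds of the fact, for a
  `g_y`-orthonormal frame `b` with `‖b_a‖ ≤ κ` and `‖G(y)‖ ≤ Λ_g`,
  `(4λ / (4(Λ_gκ)²)) ‖η‖² ≤ ∂_r𝒫[η ⊗ η] ≤ 4Λ · 4κ² ‖η‖²` with the constants `λ, Λ` of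
  `uniformlyElliptic_along_solution` (frame form: `symbol_uniformlyElliptic_along_solution`;
  comparison of norms: `sum_sq_frame_le`, `norm_sq_le_sum_sq_frame`).

## References

* M. J. Gursky, J. A. Viaclovsky, J. Differential Geom. 63 (2003) 131–154, §1 (change1)–(PDE),
  §2 Def. 2, Prop. 6. [GurskyViaclovsky2003]
* D. Gilbarg, N. S. Trudinger, *Elliptic Partial Differential Equations of Second Order* (2001),
  §17.4, (17.43), Thm. 17.14, Lemma 17.16. [GilbargTrudinger2001]
-/

noncomputable section

set_option maxSynthPendingDepth 3

open scoped Manifold ContDiff Topology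
open Set Function Module Finset

namespace Literature.Geometry.Riemannian.GurskyViaclovskyPath

open Literature.Geometry.Lorentzian (PseudoRiemannianMetric)
open Literature.Geometry.Lorentzian.PseudoRiemannianMetric
open Literature.Geometry.Lorentzian
open Literature.Geometry.Lorentzian.MetricCoord
open Literature.Geometry.Riemannian.GurskyViaclovsky

/-! ### Joint smoothness in `(t, y, p, r)` -/

section Smoothness

variable {E : Type*} [NormedAddCommGroup E] [NormedSpace ℝ E] [FiniteDimensional ℝ E]
  [CompleteSpace E] {G : E → E →L[ℝ] E →L[ℝ] ℝ} {V : Set E}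
  {X : Type*} [NormedAddCommGroup X] [NormedSpace ℝ X] {D : Set X} {π : X → E}

/-- **The metric trace of a smooth field of bilinear forms along a smooth map into `V` is
smooth**: for `π : X → E` smooth on `D` with `π(D) ⊆ V` and `β` smooth on `D`,
`x ↦ tr_{G(π x)} β(x)` is `C^∞` on `D`. [folklore] -/
theorem contDiffOn_mtrAt_comp (hG : IsMetricOn G V) (hπ : ContDiffOn ℝ ∞ π D) (hD : MapsTo π D V)
    {β : X → E →L[ℝ] E →L[ℝ] ℝ} (hβ : ContDiffOn ℝ ∞ β D) :
    ContDiffOn ℝ ∞ (fun x ↦ mtrAt G (π x) (β x)) D := by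
  simp only [mtrAt_eq_traceCLM]
  have hS : ContDiffOn ℝ ∞ (fun x ↦ sharpAt G (π x)) D := hG.contDiffOn_sharpAt.comp hπ hD
  exact (traceCLM E).contDiff.comp_contDiffOn (hS.clm_comp hβ)

/-- **The metric square norm of a smooth field of bilinear forms along a smooth map into `V` is
smooth.** [folklore] -/
theorem contDiffOn_normSqAt_comp (hG : IsMetricOn G V) (hπ : ContDiffOn ℝ ∞ π D)
    (hD : MapsTo π D V) {β : X → E →L[ℝ] E →L[ℝ] ℝ} (hβ : ContDiffOn ℝ ∞ β D) :
    ContDiffOn ℝ ∞ (fun x ↦ normSqAt G (π x) (β x)) D := by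
  simp only [normSqAt_eq_traceCLM]
  have hS : ContDiffOn ℝ ∞ (fun x ↦ sharpAt G (π x)) D := hG.contDiffOn_sharpAt.comp hπ hD
  set fl : (E →L[ℝ] E →L[ℝ] ℝ) ≃ₗᵢ[ℝ] (E →L[ℝ] E →L[ℝ] ℝ) := ContinuousLinearMap.flipₗᵢ ℝ E E ℝ
    with hfl
  have hflip : ContDiffOn ℝ ∞ (fun x ↦ fl (β x)) D := fl.contDiff.comp_contDiffOn hβ
  exact (traceCLM E).contDiff.comp_contDiffOn
    ((hS.clm_comp hβ).clm_comp (hS.clm_comp hflip))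

omit [FiniteDimensional ℝ E] in
/-- **The coordinate Hessian of a smoothly varying jet is smooth**: for `π`, `p`, `r` smooth on
`D` with `π(D) ⊆ V`, `x ↦ r(x) − p(x) ∘ Γ_{π x}` is `C^∞` on `D`. [folklore] -/
theorem contDiffOn_coordHess_comp (hG : IsMetricOn G V) (hπ : ContDiffOn ℝ ∞ π D)
    (hD : MapsTo π D V) {p : X → E →L[ℝ] ℝ} {r : X → E →L[ℝ] E →L[ℝ] ℝ}
    (hp : ContDiffOn ℝ ∞ p D) (hr : ContDiffOn ℝ ∞ r D) :
    ContDiffOn ℝ ∞ (fun x ↦ coordHess G (π x) (p x) (r x)) D := by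
  set cL : (E →L[ℝ] ℝ) →L[ℝ] (E →L[ℝ] E) →L[ℝ] (E →L[ℝ] ℝ) := ContinuousLinearMap.compL ℝ E E ℝ
    with hcL
  have h2 : ContDiffOn ℝ ∞ (fun x ↦ cL (p x)) D := cL.contDiff.comp_contDiffOn hp
  have h3 : ContDiffOn ℝ ∞ (fun x ↦ chrAt G (π x)) D := hG.contDiffOn_chrAt.comp hπ hD
  exact hr.sub (h2.clm_comp h3)

/-- **Gursky–Viaclovsky's form along smoothly varying data is smooth**: for `τ : X → ℝ`,
`π : X → V`, `p`, `r` smooth on `D`, `x ↦ 𝒜^{τ x}(π x, p x, r x)` is `C^∞` on `D` (Christoffel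
symbols, Ricci and scalar curvature of the components and `G⁻¹` are `C^∞` on `V`; `τ` and the
jet enter polynomially). [cite: GurskyViaclovsky2003, §1 (change1)] -/
theorem contDiffOn_gvForm_comp (hG : IsMetricOn G V) {τ : X → ℝ} (hτ : ContDiffOn ℝ ∞ τ D)
    (hπ : ContDiffOn ℝ ∞ π D) (hD : MapsTo π D V) {p : X → E →L[ℝ] ℝ}
    {r : X → E →L[ℝ] E →L[ℝ] ℝ} (hp : ContDiffOn ℝ ∞ p D) (hr : ContDiffOn ℝ ∞ r D) :
    ContDiffOn ℝ ∞ (fun x ↦ gvForm G (τ x) (π x) (p x) (r x)) D := by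
  have hGx : ContDiffOn ℝ ∞ (fun x ↦ G (π x)) D := hG.contDiffOn.comp hπ hD
  have hRic : ContDiffOn ℝ ∞ (fun x ↦ ricAt G (π x)) D := hG.contDiffOn_ricAt.comp hπ hD
  have hScal : ContDiffOn ℝ ∞ (fun x ↦ scalAt G (π x)) D := hG.contDiffOn_scalAt.comp hπ hD
  have hS : ContDiffOn ℝ ∞ (fun x ↦ sharpAt G (π x)) D := hG.contDiffOn_sharpAt.comp hπ hD
  have hH := contDiffOn_coordHess_comp hG hπ hD hp hr
  have htr := contDiffOn_mtrAt_comp hG hπ hD hH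
  -- `p (♯ p)`
  have hpsp : ContDiffOn ℝ ∞ (fun x ↦ p x (sharpAt G (π x) (p x))) D :=
    hp.clm_apply (hS.clm_apply hp)
  -- `p ⊗ p`
  have hpp : ContDiffOn ℝ ∞ (fun x ↦ (p x).smulRight (p x)) D := by
    have hb : ContDiff ℝ ∞ (fun q : (E →L[ℝ] ℝ) × (E →L[ℝ] ℝ) ↦ q.1.smulRight q.2) :=
      (isBoundedBilinearMap_smulRight (𝕜 := ℝ) (E := E) (F := E →L[ℝ] ℝ)).contDiff
    exact hb.comp_contDiffOn (hp.prodMk hp)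
  have hA1 : ContDiffOn ℝ ∞
      (fun x ↦ (1 / 2 : ℝ) • (ricAt G (π x) - (τ x / 6 * scalAt G (π x)) • G (π x))) D :=
    (hRic.sub (((hτ.div_const 6).mul hScal).smul hGx)).const_smul (1 / 2 : ℝ)
  have hA2 : ContDiffOn ℝ ∞
      (fun x ↦ ((1 - τ x) / 2 * mtrAt G (π x) (coordHess G (π x) (p x) (r x))) • G (π x)) D :=
    ((((contDiffOn_const (c := (1 : ℝ))).sub hτ).div_const 2).mul htr).smul hGx
  have hA3 : ContDiffOn ℝ ∞
      (fun x ↦ ((2 - τ x) / 2 * p x (sharpAt G (π x) (p x))) • G (π x)) D :=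
    ((((contDiffOn_const (c := (2 : ℝ))).sub hτ).div_const 2).mul hpsp).smul hGx
  have h := (((hA1.add hH).add hA2).add hpp).sub hA3
  exact h.congr fun x _ ↦ rfl

/-- **The chart operator along smoothly varying data is smooth**: for `τ, w : X → ℝ`,
`π : X → V`, `p`, `r` smooth on `D`, `x ↦ chartOperator G (τ x) (w x) (π x) (p x) (r x)` is
`C^∞` on `D`. [cite: GurskyViaclovsky2003, §1 (change1)–(PDE)] -/
theorem contDiffOn_chartOperator_comp (hG : IsMetricOn G V) {τ w : X → ℝ}
    (hτ : ContDiffOn ℝ ∞ τ D) (hw : ContDiffOn ℝ ∞ w D) (hπ : ContDiffOn ℝ ∞ π D)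
    (hD : MapsTo π D V) {p : X → E →L[ℝ] ℝ} {r : X → E →L[ℝ] E →L[ℝ] ℝ}
    (hp : ContDiffOn ℝ ∞ p D) (hr : ContDiffOn ℝ ∞ r D) :
    ContDiffOn ℝ ∞ (fun x ↦ chartOperator G (τ x) (w x) (π x) (p x) (r x)) D := by
  have hA := contDiffOn_gvForm_comp hG hτ hπ hD hp hr
  have htr := contDiffOn_mtrAt_comp hG hπ hD hA
  have hns := contDiffOn_normSqAt_comp hG hπ hD hA
  exact (contDiffOn_const.mul ((htr.pow 2).sub hns)).sub (contDiffOn_const.mul hw)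

/-- **Gursky–Viaclovsky's form `𝒜^t(y, p, r)` is jointly smooth in `(t, y, p, r)`** on
`ℝ × V × E* × Bil(E)` (it is affine in `t`). [cite: GurskyViaclovsky2003, §1 (change1)] -/
theorem contDiffOn_gvForm_param (hG : IsMetricOn G V) :
    ContDiffOn ℝ ∞
      (fun x : ℝ × E × (E →L[ℝ] ℝ) × (E →L[ℝ] E →L[ℝ] ℝ) ↦ gvForm G x.1 x.2.1 x.2.2.1 x.2.2.2)
      {x | x.2.1 ∈ V} := by
  have hπ : ContDiffOn ℝ ∞ (fun x : ℝ × E × (E →L[ℝ] ℝ) × (E →L[ℝ] E →L[ℝ] ℝ) ↦ x.2.1)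
      {x | x.2.1 ∈ V} := contDiff_snd.fst.contDiffOn
  exact contDiffOn_gvForm_comp hG contDiff_fst.contDiffOn hπ (fun _ hx ↦ hx)
    contDiff_snd.snd.fst.contDiffOn contDiff_snd.snd.snd.contDiffOn

/-- **The chart operator is jointly smooth in `(t, y, p, r)`** (it is a quadratic polynomial in
`t` with coefficients smooth in `(y, p, r)`). [cite: GurskyViaclovsky2003, §1 (change1)–(PDE)] -/
theorem contDiffOn_chartOperator_param (hG : MetricCoord.IsMetricOn G V) {W : E → ℝ}
    (hW : ContDiffOn ℝ ∞ W V) :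
    ContDiffOn ℝ ∞
      (fun x : ℝ × E × (E →L[ℝ] ℝ) × (E →L[ℝ] E →L[ℝ] ℝ) ↦
        chartOperator G x.1 (W x.2.1) x.2.1 x.2.2.1 x.2.2.2)
      {x | x.2.1 ∈ V} := by
  have hπ : ContDiffOn ℝ ∞ (fun x : ℝ × E × (E →L[ℝ] ℝ) × (E →L[ℝ] E →L[ℝ] ℝ) ↦ x.2.1)
      {x | x.2.1 ∈ V} := contDiff_snd.fst.contDiffOn
  have hD : MapsTo (fun x : ℝ × E × (E →L[ℝ] ℝ) × (E →L[ℝ] E →L[ℝ] ℝ) ↦ x.2.1)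
      {x | x.2.1 ∈ V} V := fun _ hx ↦ hx
  exact contDiffOn_chartOperator_comp hG contDiff_fst.contDiffOn (hW.comp hπ hD) hπ hD
    contDiff_snd.snd.fst.contDiffOn contDiff_snd.snd.snd.contDiffOn

end Smoothness

/-! ### The symbol in Euclidean coordinates -/

section OpensChart

variable {U : TopologicalSpace.Opens (EuclideanSpace ℝ (Fin 4))}
  (g : PseudoRiemannianMetric 𝓘(ℝ, EuclideanSpace ℝ (Fin 4)) ∞ (EuclideanSpace ℝ (Fin 4))
    (TangentSpace 𝓘(ℝ, EuclideanSpace ℝ (Fin 4)) : U → Type _))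
  [g.HasLeviCivita]
  {G : EuclideanSpace ℝ (Fin 4) →
    EuclideanSpace ℝ (Fin 4) →L[ℝ] EuclideanSpace ℝ (Fin 4) →L[ℝ] ℝ}
  (hG : ∀ y : U, g.val y = G y)

omit [g.HasLeviCivita] in
include hG in
/-- **The chart operator is smooth in `r`** at fixed `(t, W, y, p)` with `y ∈ U` (restriction of
`contDiffOn_chartOperator` along the inclusion `r ↦ (y, p, r)`). [folklore] -/
theorem contDiff_chartOperator_right (t W : ℝ) (y : U) (p : EuclideanSpace ℝ (Fin 4) →L[ℝ] ℝ) :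
    ContDiff ℝ ∞ (fun r ↦ chartOperator G t W y p r) := by
  have hmet : MetricCoord.IsMetricOn G (U : Set (EuclideanSpace ℝ (Fin 4))) :=
    OpensChart.isMetricOn_repr hG
  have hco := contDiffOn_chartOperator hmet t (W := fun _ ↦ W) contDiffOn_const
  have hι : ContDiff ℝ ∞
      (fun r : EuclideanSpace ℝ (Fin 4) →L[ℝ] EuclideanSpace ℝ (Fin 4) →L[ℝ] ℝ ↦
        ((y : EuclideanSpace ℝ (Fin 4)), p, r)) :=
    contDiff_const.prodMk (contDiff_const.prodMk contDiff_id)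
  simpa only [Function.comp_def] using hco.comp_contDiff hι fun _ ↦ y.2

include hG in
/-- **The `r`-derivative of the chart operator in a rank-one direction is the symbol.** For a
symmetric `r`, a covector `η` and a `g_y`-orthonormal frame `b`,
`D_r(chartOperator G t W y p ·)(r)[η ⊗ η] = 4 Σ_{ac} L^t(M)_{ac} ζ_aζ_c`, `ζ_a = η(b_a)`,
`M_{ac} = 𝒜^t(y,p,r)(b_a,b_c)` (the operator is smooth in `r`, so the Fréchet derivative along
the line `r + εη ⊗ η` is the derivative of `hasDerivAt_chartOperator`).
[cite: GurskyViaclovsky2003, §2, Def. 2 and Prop. 2] -/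
theorem fderiv_chartOperator_smulRight (t W : ℝ) (y : U)
    {b : Basis (Fin 4) ℝ (TangentSpace 𝓘(ℝ, EuclideanSpace ℝ (Fin 4)) y)}
    (hb : g.IsOrthonormalFrame y b) (p : EuclideanSpace ℝ (Fin 4) →L[ℝ] ℝ)
    {r : EuclideanSpace ℝ (Fin 4) →L[ℝ] EuclideanSpace ℝ (Fin 4) →L[ℝ] ℝ}
    (hr : ∀ v w, r v w = r w v) (η : EuclideanSpace ℝ (Fin 4) →L[ℝ] ℝ) :
    fderiv ℝ (fun r' ↦ chartOperator G t W y p r') r (η.smulRight η) =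
      4 * quadForm (ellOp t fun a c ↦ gvForm G t y p r (b a) (b c)) fun a ↦ η (b a) := by
  set φ := fun r' ↦ chartOperator G t W y p r' with hφ
  have hdφ : DifferentiableAt ℝ φ r :=
    ((contDiff_chartOperator_right g hG t W y p).differentiable (by simp)).differentiableAt
  have hℓ : HasDerivAt (fun ε : ℝ ↦ r + ε • η.smulRight η) (η.smulRight η) 0 := by
    simpa using ((hasDerivAt_id (0 : ℝ)).smul_const (η.smulRight η)).const_add r
  have h1 : HasDerivAt (fun ε : ℝ ↦ φ (r + ε • η.smulRight η))
      (fderiv ℝ φ r (η.smulRight η)) 0 :=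
    hdφ.hasFDerivAt.comp_hasDerivAt_of_eq (0 : ℝ) hℓ (by simp)
  exact h1.unique (hasDerivAt_chartOperator g hG t W y hb p hr η)

include hG in
/-- **Two-sided bounds for the chart symbol against the Euclidean norm of the covector.** With
the hypotheses of `symbol_uniformlyElliptic_along_solution` at a point `y` of the chart domain, a
`g_y`-orthonormal frame `b` with `‖b_a‖ ≤ κ` and `‖G(y)‖ ≤ Λ_g`, the `r`-derivative of the chart
operator at the jet of `F` in the rank-one direction `η ⊗ η` (which exists: the operator is smooth
in `r`, and equals the value of `hasDerivAt_chartOperator`) is pinched between explicit positive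
multiples of `‖η‖²`: `(4λ/(4(Λ_g κ)²))‖η‖² ≤ ∂_r 𝒫[η⊗η] ≤ 4Λ·4κ²‖η‖²` with the constants `λ, Λ`
of `uniformlyElliptic_along_solution` (frame norm versus Euclidean norm:
`sum_sq_frame_le`, `norm_sq_le_sum_sq_frame`).
[cite: GurskyViaclovsky2003, Prop. 6 (proof)] [cite: GilbargTrudinger2001, §17.4, (17.43)] -/
theorem symbol_euclid_bounds_along_solution (hg : g.IsRiemannian) {f : U → ℝ}
    (hf : ContMDiff 𝓘(ℝ, EuclideanSpace ℝ (Fin 4)) 𝓘(ℝ) ∞ f) {F : EuclideanSpace ℝ (Fin 4) → ℝ}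
    (hfF : ∀ y : U, f y = F y) {q : U → ℝ} {t q₀ C P T : ℝ} (ht : t ≤ 1) (htT : |t| ≤ T)
    (hq₀ : 0 < q₀) (hC : 0 ≤ C) (hP : 0 ≤ P) (y : U) (hF : ContDiffAt ℝ 2 F y) (hqy : q₀ ≤ q y)
    (heq : backgroundPathOperator g t (fun z ↦ -f z) y = q y * Real.exp (-4 * (-f y)))
    (hpos : 0 < backgroundScalar g (fun z ↦ -f z) y)
    (hfy : |f y| ≤ C) (hgrad : g.gradSq f y ≤ C) (hhess : g.normSq y (g.hessian f y) ≤ C)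
    (hRic : g.normSq y (g.ricci y) ≤ P ^ 2) (hR : |g.scalarCurvature y| ≤ P)
    {b : Basis (Fin 4) ℝ (TangentSpace 𝓘(ℝ, EuclideanSpace ℝ (Fin 4)) y)}
    (hb : g.IsOrthonormalFrame y b) {κ Λg : ℝ} (hκ0 : 0 ≤ κ)
    (hκ : ∀ a, @norm (EuclideanSpace ℝ (Fin 4)) _ (b a) ≤ κ) (hΛg : ‖G y‖ ≤ Λg) (W : ℝ)
    (η : EuclideanSpace ℝ (Fin 4) →L[ℝ] ℝ) :
    4 * (q₀ * Real.exp (-4 * C) / 4 /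
          (2 * (4 * ((1 + T) * P + (3 + 2 * T) * Real.sqrt C + (5 + 2 * T) * C) + 1))) /
        ((Λg * κ) ^ 2 * 4) * ‖η‖ ^ 2 ≤
      fderiv ℝ (fun r ↦ chartOperator G t W y (fderiv ℝ F y) r) (fderiv ℝ (fderiv ℝ F) y)
        (η.smulRight η) ∧
    fderiv ℝ (fun r ↦ chartOperator G t W y (fderiv ℝ F y) r) (fderiv ℝ (fderiv ℝ F) y)
        (η.smulRight η) ≤
      4 * (3 * (4 * ((1 + T) * P + (3 + 2 * T) * Real.sqrt C + (5 + 2 * T) * C) + 1) * (2 - t)) *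
        (4 * κ ^ 2) * ‖η‖ ^ 2 := by
  -- the derivative is the symbol, pinched in the frame norm
  have hr : ∀ v w, fderiv ℝ (fderiv ℝ F) y v w = fderiv ℝ (fderiv ℝ F) y w v := fun v w ↦
    (hF.isSymmSndFDerivAt (by simp)).eq v w
  have hval := fderiv_chartOperator_smulRight g hG t W y hb (fderiv ℝ F y) hr η
  obtain ⟨k1, k2⟩ := symbol_uniformlyElliptic_along_solution g hG hg hf hfF ht htT hq₀ hC hP y hF
    hqy heq hpos hfy hgrad hhess hRic hR hb η
  rw [← hval] at k1 k2
  -- frame norm versus Euclidean norm of `η`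
  set e : Fin 4 → EuclideanSpace ℝ (Fin 4) := fun a ↦ b a with he_def
  have hE : finrank ℝ (EuclideanSpace ℝ (Fin 4)) = 4 := finrank_euclideanSpace_fin
  have hon : ∀ a c, G y (e a) (e c) = if a = c then 1 else 0 := by
    intro a c
    have h1 : G y (e a) (e c) = g.val y (b a) (b c) :=
      (congrArg (fun B : EuclideanSpace ℝ (Fin 4) →L[ℝ] EuclideanSpace ℝ (Fin 4) →L[ℝ] ℝ ↦
        B (b a) (b c)) (hG y)).symm
    rw [h1]
    by_cases hac : a = c
    · subst hac; simp [hb.1 a]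
    · simp [hac, hb.2 a c hac]
  have hexp : ∀ v, ∑ a, G y v (e a) • e a = v := sum_smul_frame_eq hE (G y) e hon
  have hκe : ∀ a, ‖e a‖ ≤ κ := hκ
  have hup : ∑ a, η (b a) ^ 2 ≤ 4 * κ ^ 2 * ‖η‖ ^ 2 := by
    have h := sum_sq_frame_le e hκe η
    rw [Fintype.card_fin] at h
    push_cast at h
    exact h
  have hlow : ‖η‖ ^ 2 ≤ (Λg * κ) ^ 2 * 4 * ∑ a, η (b a) ^ 2 := by
    have h := norm_sq_le_sum_sq_frame (G y) e hexp hΛg hκe hκ0 η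
    rw [Fintype.card_fin] at h
    push_cast at h
    exact h
  -- signs of the constants
  have hT : 0 ≤ T := (abs_nonneg t).trans htT
  set K := (1 + T) * P + (3 + 2 * T) * Real.sqrt C + (5 + 2 * T) * C with hK_def
  have hK0 : 0 ≤ K := by rw [hK_def]; positivity
  set lam := q₀ * Real.exp (-4 * C) / 4 / (2 * (4 * K + 1)) with hlam_def
  have hlam0 : 0 ≤ lam := by rw [hlam_def]; positivity
  set Lam := 3 * (4 * K + 1) * (2 - t) with hLam_def
  have hLam0 : 0 ≤ Lam := by rw [hLam_def]; exact mul_nonneg (by positivity) (by linarith)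
  have hS0 : 0 ≤ ∑ a, η (b a) ^ 2 := Finset.sum_nonneg fun a _ ↦ sq_nonneg _
  constructor
  · -- lower bound
    by_cases hD : (Λg * κ) ^ 2 * 4 = 0
    · rw [hD, div_zero, zero_mul]
      exact le_trans (mul_nonneg (mul_nonneg (by norm_num) hlam0) hS0) k1
    · have hD0 : 0 < (Λg * κ) ^ 2 * 4 := lt_of_le_of_ne (by positivity) (Ne.symm hD)
      rw [div_mul_eq_mul_div, div_le_iff₀ hD0]
      calc 4 * lam * ‖η‖ ^ 2 ≤ 4 * lam * ((Λg * κ) ^ 2 * 4 * ∑ a, η (b a) ^ 2) :=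
            mul_le_mul_of_nonneg_left hlow (by positivity)
        _ = 4 * lam * (∑ a, η (b a) ^ 2) * ((Λg * κ) ^ 2 * 4) := by ring
        _ ≤ _ := mul_le_mul_of_nonneg_right k1 hD0.le
  · -- upper bound
    calc _ ≤ 4 * Lam * ∑ a, η (b a) ^ 2 := k2
      _ ≤ 4 * Lam * (4 * κ ^ 2 * ‖η‖ ^ 2) := mul_le_mul_of_nonneg_left hup (by positivity)
      _ = 4 * Lam * (4 * κ ^ 2) * ‖η‖ ^ 2 := by ring

end OpensChart

end Literature.Geometry.Riemannian.GurskyViaclovskyPath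

end
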